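import Mathlib
import HarnessLib
import HarnessLib.Audit
import Summits.AtomisticToContinuum.Statement
import Literature.MathematicalPhysics.KineticTheory.LangevinChainNESS
import Literature.Barriers.AtomisticToContinuum.FixedLengthNoConductivityControl
import Summits.AtomisticToContinuum.FouriersLaw.Theorems.EmbeddedDrudeMourreNessUnique
import Summits.AtomisticToContinuum.FouriersLaw.Theorems.FourierGreenKuboFourierFiniteResponseOfUnique

/-!
Route: DilutePhononLorentzGas

CLOSED (retired) 2026-08-15T13:41:48Z by operator:999:1257524 — reason: not-a-thesis: assembly does not conclude the sub-problem Statement — note: D-0027 §2.1 audit (human 2026-08-15: routes that do not decide the summit are removed): the assembly concludes `Literature.MathematicalPhysics.KineticTheory.HeatConduction.FouriersLaw`, not the sub-problem statement; a NEW conforming route may be opened from the same idea (generated `closes : … → _r. The file is kept as the record of this route; refuted decls are indexed as negative knowledge (`ledger negatives`).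

# Route DilutePhononLorentzGas — Dilute quartic cells in the harmonic host conduct Ohmically by
renewal; cell monotonicity carries bounded response down to the dense chain

Realises the card dilute-nonlinearity-phonon-lorentz-gas (phonon Lorentz gas: sparse O(1) quartic
cells in the exactly solvable pinned harmonic host are Hamiltonian Buttiker probes). It suffices to
show X = X_bdd ∧ X_lim together with the conjunct's plumbing (NessUnique, FiniteResponseOfUnique,
both shared with route FourierGreenKubo):
X_bdd (item BoundedResponse): for all ω₂, lam, β, γ > 0 and every T > 0 the finite-size conductivity
κ_N = D_N(T) of pinnedChain ω₂ lam β γ is bounded uniformly in N — `HasBoundedResponse`, the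
documented missing "dependence of D on L" (barrier file FixedLengthNoConductivityControl), necessary
for the conjunct (`hasBoundedResponse_of_fouriersLawFor`). The route reaches X_bdd by a
DILUTE-NONLINEARITY LADDER: put the conjunct's quartic terms only on every ℓ-th site/bond of the
harmonic host (cell chains P_ℓ, P_1 = pinnedChain); between cells transport is the proved ballistic
harmonic flight (HarmonicChainBallisticFlux_holds); one cell in the band-limited thermal lattice
field is mixing (crux CellMixing), so for ℓ → ∞ successive scatterings decorrelate and the
end-to-end resistance is a renewal sum r₀ + M·r₁(T) over the M cells (kinetic window), and keeps
growing at least linearly in M beyond the window (crux DiluteCellsBoundedResponse: κ_N(P_ℓ) bounded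
in N for ℓ ≥ ℓ₀(T)); adding quartic cells to the ORDERED host never raises κ_N (crux
CellMonotonicity), which carries the bound from P_ℓ₀ down to P_1.
X_lim (item BoundedToFourier): for pinnedChain, uniqueness of the weak steady state + existence of
the response limits + sup_N |D_N(T)| < ∞ upgrade to clause (ii) of FouriersLawFor: D_N(T) → κ(T) >
0.
Lean: `(∀ ω₂ lam β γ : ℝ, 0 < ω₂ → 0 < lam → 0 < β → 0 < γ →
Literature.Barriers.AtomisticToContinuum.HasBoundedResponse
(Literature.MathematicalPhysics.KineticTheory.HeatConduction.pinnedChain ω₂ lam β γ))` (= X_bdd;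
X_lim, NessUnique, FiniteResponseOfUnique are the typed items below; all four elaborate in the
planner's Sketch.lean, where the Assembly glue is also proved as a sanity check).

## Assembly
Pure logic over the conjunct's definition: the proved existence fact (N ≥ 1; N = 0 by
OscillatorChain.isSteadyState_zero) and NessUnique give clause (i) of FouriersLawFor;
FiniteResponseOfUnique, BoundedResponse and BoundedToFourier give clause (ii); FouriersLaw is the
∀-closure of (i) ∧ (ii). The first hypothesis is the PROVED cone fact
CuneoEckmannHairerReyBellet2018_pinnedChain (CuneoEckmannHairerReyBellet2018_pinnedChain_holds,
LangevinChainNESSHolds.lean). The statements are inlined (same text as the items) so the term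
elaborates standalone; a 12-line proof is in the planner's Sketch.lean.

Rationale: WHY THIS LINE. The conjunct has no small parameter, and both perturbative corners are catalogued
dead ends (harmonic point ballistic, weak anharmonicity degenerates as (λT)⁻²); the card's move is
to make the nonlinearity DILUTE instead of weak: anharmonicity stays O(1) at each cell, only its
support thins (1/ℓ → 0), and the refuted harmonic crystal becomes the free flight of a Lorentz gas
of phonons (Gallavotti1969, Spohn1978 transplanted: dilute random scatterers ↦ dilute
deterministic-but-thermal scatterers; Boltzmann–Grad window ↦ ℓ large against the cell mixing time).
Imported areas: kinetic/low-density limits (Gallavotti1969; for waves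
doi:10.1142/s0129055x0500242x), return to equilibrium of a small Hamiltonian system in an infinite
harmonic field (JaksicPillet1998; lattice bath: BonettoMaiocchi2026 = arXiv:2510.20003), dephasing
probes ⇒ series resistance (Buttiker1986; self-consistent reservoirs BonettoLebowitzLukkarinen2004,
Dhar2008 §3.5), renewal/gambler's-ruin for the crossing probability. What the route adds to the
card: the card's ladder stops at dilute chains; here the ladder is made LOAD-BEARING for the
conjunct through the comparison principle CellMonotonicity (switching on quartic cells in the
ordered host can only add resistance), which transfers the N-uniform conductivity bound from P_ℓ₀ to
pinnedChain and so delivers HasBoundedResponse — half of Fourier's law (finiteness of κ, no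
anomalous conduction) for a deterministic Hamiltonian-bulk chain; the other half (existence and
positivity of lim D_N) is isolated as BoundedToFourier. No prior route uses inhomogeneous chains,
comparison in the set of anharmonic sites, or a kinetic limit in the DENSITY of nonlinearity; the
negatives index is empty at filing.

RANKED CRUXES. Three cruxes need the site-inhomogeneous cell chain, which Lean lacks (definition
request CellChain below); they are filed right after open with `ledger workitem add --informal` and
typed by `set-signature` when the definition lands. In rank order:
Rank 2, CellMixing (informal) — ONE CELL THERMALISES IN THE LATTICE FIELD: the infinite chain on ℤ,
harmonic (pinning ω₂ > 0, unit coupling) except quartic pinning lam·q₀⁴/4 at site 0 and quartic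
coupling β(q₁−q₀)⁴/4 on the bond (0,1), in its Gibbs state at T > 0, is mixing for cell-local
observables, with a rate m_T(t) → 0 for functions of the cell energy. Why it might fail: an isolated
hard-quartic site in a LINEAR lattice should carry exact breathers (frequency above the band
√(ω₂+4), all odd harmonics above it too, nothing resonates with the leads), so at T > 0 relaxation
comes only from inelastic phonon–breather scattering and may be far from exponential; even a linear
resonant probe in a lattice bath keeps power-law memory (BonettoMaiocchi2026 Thms 2–3);
JaksicPillet1998 needs a field with unbounded spectrum. Sources: JaksicPillet1998,
BonettoMaiocchi2026, HairerMattingly2009.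
Rank 3, CellMonotonicity (informal) — ADDING CELLS NEVER HELPS CONDUCTION: for cell chains P_c
(quartic terms of pinnedChain switched on exactly at the sites/bonds flagged by c : ℕ → Bool,
harmonic ω₂-pinned unit-coupling host elsewhere, Langevin baths γ at the ends), all parameters > 0,
every T > 0 and indicators c ≤ c′: eventually in N the response coefficients satisfy 0 ≤ D_N(c′,T) ≤
D_N(c,T) (the glue needs only c = periodic c_ℓ₀, c′ ≡ true, up to a constant factor). Why it might
fail: coherent anti-reflection — at low T cells are quasi-elastic weak scatterers and an added cell
can impedance-match its neighbours on the band frequencies carrying the current; the sign is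
host-dependent (anharmonicity RAISES the current of a disordered harmonic host, DharLebowitz2008),
so the claim is specific to the ordered host and to large N. Sources: Buttiker1986, Dhar2008 §3.5,
DharLebowitz2008, BonettoLebowitzReyBellet2000 §6.3 (D_N is an equilibrium response, eq. (35):
compare on the Kubo side).
Rank 4, DiluteCellsBoundedResponse (informal) — THE LADDER'S TOP RUNG: ∀ parameters > 0 ∀ T > 0 ∃ ℓ₀
∀ ℓ ≥ ℓ₀ the periodic cell chain P_ℓ (cells at sites ≡ ℓ−1 mod ℓ) has sup_N |D_N(P_ℓ,T)| < ∞ along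
every steady-state family with response limits (expected value ≈ ℓ/r₁(T), r₁ = (1−τ)/(τ c_∞) the
single-cell excess resistance, c_∞ the RLL ballistic coefficient). Why it might fail: inside the
kinetic window (M ≤ M_T(ℓ) cells) this is a renewal theorem, but for fixed ℓ and M → ∞ the residual
inter-cell memory after the return time 2ℓ/v_max must not accumulate; band-edge memory in a lattice
bath decays only like a power law (BonettoMaiocchi2026), so per-visit errors need not be summable
and the MacroErgodicity-type obstruction re-enters at fixed ℓ; also ℓ₀(T) → ∞ as T ↓ 0 (cells become
transparent, τ → 1). Sources: Gallavotti1969, Spohn1978, Buttiker1986,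
BonettoLebowitzLukkarinen2004, BricmontKupiainen2013, BonettoMaiocchi2026.
#5 BoundedResponse (crux) — κ_N bounded uniformly in N for the conjunct's chain: for all ω₂, lam, β,
γ > 0, HasBoundedResponse (pinnedChain ω₂ lam β γ) — the dense waypoint; delivered by
DiluteCellsBoundedResponse + CellMonotonicity through the glue DiluteToDense (two-layer plan),
direct attacks welcome (it is the typed parent of the foreseen split). [difficulty: open-problem]
(why it might fail: anomalous (super-diffusive) conduction despite pinning would make κ_N unbounded;
not expected for lam, β > 0 (J ~ 1/N numerically) but open for every deterministic anharmonic chain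
(BLR2000 §6.3), and false at lam = β = 0 (not_hasBoundedResponse).) [BonettoLebowitzReyBellet2000,
AokiLukkarinenSpohn2006, BonettoLebowitzLukkarinenOlla2009]
#6 BoundedToFourier (crux) — the complement on the dense chain: for all parameters > 0, uniqueness
of the weak steady state for all N, T_L, T_R > 0, existence of the response limits D_N(T) along
every steady-state family, and HasBoundedResponse together give clause (ii) of FouriersLawFor: some
κ : ℝ → ℝ with κ(T) > 0 and D_N(T) → κ(T) for every T > 0 (an a-priori linear resistance bound is
exactly what a subadditivity / compactness-plus-identification argument needs to start; shared
territory with FourierGreenKubo.ThermodynamicLimit and the card fekete-resistance-subadditivity).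
[deps: BoundedResponse] [difficulty: open-problem] (why it might fail: bounded but non-convergent
D_N (persistent parity / commensurability oscillations from boundary resonances) or D_N → 0
(insulating limit): lower bounds on the current of deterministic anharmonic chains are as open as
upper ones (BLR2000 §6.3, §7).) [BonettoLebowitzReyBellet2000, CuneoEckmannHairerReyBellet2018]
#9 NessUnique (support) — uniqueness of the weak (Fokker–Planck) steady state of pinnedChain in the
class IsSteadyState, for all parameters, N and T_L, T_R > 0 — clause (i) of FouriersLawFor,
uniqueness half (existence is the proved fact CuneoEckmannHairerReyBellet2018_pinnedChain_holds);
same statement as FourierGreenKubo.NessUnique (dedup expected). [difficulty: L]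
[CuneoEckmannHairerReyBellet2018, ReyBelletThomas2002, Carmona2007]
#9 FiniteResponseOfUnique (support) — under uniqueness, the finite-N linear-response limit D_N(T) =
lim_{δ→0} totalCurrent(μ_{N,T+δ/2,T−δ/2})/δ exists for every steady-state family, T > 0 and N
(Hairer–Majda linear response for hypoelliptic diffusions with Lyapunov structure); same statement
as FourierGreenKubo.FourierFiniteResponseOfUnique (dedup expected). [difficulty: L]
[arXiv:0909.4313, CuneoEckmannHairerReyBellet2018, BonettoLebowitzReyBellet2000]

TWO-LAYER PLAN. Foreseen split (filed by `route edit --split BoundedResponse` once the CellChain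
definition lands and CellMonotonicity / DiluteCellsBoundedResponse are typed): BoundedResponse ⇐
DiluteCellsBoundedResponse → CellMonotonicity → BoundedResponse (glue DiluteToDense: c_ℓ₀ ≤ true,
cellChain with all cells = pinnedChain by the definition's simp lemma, D_N(pinnedChain) ≤ D_N(P_ℓ₀)
≤ C eventually, finitely many N harmless, 0 ≤ D_N from the monotonicity item). Below
DiluteCellsBoundedResponse, as prover-attached supports (not items): DiluteOhmWindow — the
kinetic-window limit theorem |ρ_{Mℓ}(T) − r₀(T) − M·r₁(T)| ≤ εM for ℓ ≥ ℓ₀(ε,T), M ≤ M_T(ℓ) with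
M_T(ℓ)²·m_T(2ℓ/v_max) → 0 (renewal over cell visits; error per visit ≤ m_T(2ℓ/v_max) from CellMixing
plus the Gaussian no-return estimate for the harmonic leads, v_max = max group velocity of ω(k)² =
ω₂ + 4 sin²(k/2)); SingleCellLandauer — 0 < τ(T) < 1 and the two-lead conductance of one cell =
c_∞·τ(T); BeyondWindow — for fixed ℓ ≥ ℓ₀ the resistance of P_ℓ is ≥ c(T,ℓ)·M for all M (only a
LOWER bound on resistance is needed for bounded response). CellMixing is filed at layer 1 because it
is the common analytic input and the cheapest decisive test of the whole line.

KILL CRITERIA. CellMixing refuted (a positive-measure set of cell states that never exchanges energy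
with the thermal lattice field, or no decay of cell-energy correlations at some T > 0) closes the
route: no dephasing, no renewal. CellMonotonicity refuted in its eventual-in-N, up-to-constants form
for the pair (c_ℓ₀, true) closes the route's claim on the conjunct (the ladder then survives only as
a Literature-value programme on dilute chains and is handed to the matthiessen-increments card);
refuted only pointwise (small N, exotic c ≤ c′) ⇒ restate to the periodic pair.
DiluteCellsBoundedResponse refuted for all large ℓ (super-diffusion of the periodic dilute chain)
closes the route and is itself a major negative result. BoundedToFourier is shared territory: if
FourierGreenKubo's ThermodynamicLimit + GreenKubo cruxes get proved, this route's X_lim is moot and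
X_bdd becomes a corollary — close as superseded. ¬BoundedResponse (anomalous conduction of
pinnedChain) refutes the conjunct itself.

NOT DECOMPOSED YET. The renewal theorem (window), the single-cell Landauer datum τ(T), the
no-return/finite-speed estimate for the harmonic leads, the beyond-window stability, the
T-dependence of ℓ₀ and every constant are deliberately NOT items: they are layer-2 material under
DiluteCellsBoundedResponse / CellMixing once CellChain exists. No infinite-volume dynamics object
for the inhomogeneous chain is requested yet (CellMixing may be typed either on ℤ or uniformly in
the lead length with equilibrium Langevin ends; the grounder who types it chooses, see Definition
requests). The low-temperature crossover (ℓ₀(T) → ∞) and any claim at ℓ = 1 beyond monotone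
comparison are out of scope.

CHEAPEST FALSIFIER. Numerics a refuter can run in an hour (kit): (i) equilibrium-response or
small-δT Langevin MD of the cell chains at (ω₂, lam, β, γ, T) = (1,1,1,1,1): compare D_N for c = c_4
(cells every 4th site) against c′ ≡ true (pinnedChain) for N ∈ {16, 32, 64, 128} — CellMonotonicity
dies if D_N(true) > D_N(c_4) persistently; (ii) same runs for P_ℓ, ℓ ∈ {4, 8, 16}, M ∈ {4,…,64}: fit
R = r₀ + M·r₁(ℓ); the ladder dies if R is not affine in M or r₁(ℓ) does not saturate in ℓ; (iii)
control: replace the quartic cell by a linear mass/pinning defect — the affine law must FAIL there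
(Bloch transport for periodic placement), else the numerics do not resolve coherence and (i)–(ii)
are void. Analytic cheapest check of CellMixing: exhibit (or exclude) an exact above-band breather
at a single quartic site of the infinite linear chain (anticontinuum-free, e.g. by a
centre-manifold/variational construction); its existence does not refute mixing at T > 0 but fixes
the rate discussion.

NUMBERS. Harmonic host: band ω(k)² = ω₂ + 4 sin²(k/2), v_max = max_k |ω′(k)|; ballistic coefficient
c_∞(ω₂, γ) > 0 and D_{M+1} = M·c_{M+1} at lam = β = 0 (HarmonicChainBallisticFlux_holds,
HarmonicChainFlux.lean: lamb, rootR). Linear resonant probe in the lattice bath: thermalisation rate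
ξ(α) = α²/(2Ω√((Ω−μ₋)(μ₊−Ω))) + O(α³) inside the band, none outside, power-law remainders K_v(t) ≤
K/(1 + t(1 + α√t)) (BonettoMaiocchi2026 Thm 3, Rem 2.3). Expected window: M_T(ℓ) ≍
m_T(2ℓ/v_max)^{-1/2}; if m_T is a power law t^{-a} the window is polynomial, M ≲ ℓ^{a/2}.

DEFINITION REQUESTS. CellChain (topic Literature/MathematicalPhysics/KineticTheory; BLR2000 §3 eq.
(8) already has site-dependent U_i): a site-inhomogeneous oscillator chain `SiteChain` (U V : ℕ → ℝ
→ ℝ, γ) with hamiltonian Σ(p_i²/2 + U_i(q_i)) + Σ V_i(q_{i+1} − q_i), the Langevin generator with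
baths at sites 0 and N−1 exactly as OscillatorChain.generator, bondCurrent_i = −½(p_i +
p_{i+1})·V_i′(q_{i+1} − q_i), totalCurrent, IsSteadyState (weak Fokker–Planck + integrable
currents), the embedding OscillatorChain.toSiteChain with agreement lemmas, and the instance
cellChain ω₂ lam β γ (c : ℕ → Bool) with U_i(q) = ω₂q²/2 + [c i]·lam·q⁴/4, V_i(r) = r²/2 + [c
i]·β·r⁴/4, plus `cellChain … (fun _ => true)` ≃ pinnedChain ω₂ lam β γ and `(fun _ => false)` ≃
pinnedChain ω₂ 0 0 γ. Later (with the split): the infinite-volume one-cell dynamics on ℤ and its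
Gibbs state (pattern of InfiniteChainDynamics / IsChainGibbsMeasure), the thermal transmission τ(T),
unless CellMixing is typed uniformly in finite volume.

Novelty: Searches (2026-08-15, this session; the card's own searches of 2026-08-15 and the refuter audit are
inherited): `lit frontier AtomisticToContinuum --since 2020` (30 rows; relevant: arXiv:2510.20003
Bonetto–Maiocchi, probe + harmonic lattice bath; arXiv:2310.13338 heat equation from deterministic
dynamics with chaotic forcing), `lit bridges AtomisticToContinuum --cross any` (30 rows, none on
dilute scatterers in oscillator chains), `lit search --source crossref "monotonicity heat current
anharmonicity oscillator chain Langevin"` (10 rows, none relevant), `lit search --source zbmath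
"anharmonic defect harmonic chain heat conduction"` (1 row, irrelevant), `lit galaxy search
"anharmonic impurity in a harmonic chain heat conduction" --star all` and `"anharmonic impurities" /
"nonlinear impurity mode" --star all` (0 / 0 / 1 hit: Kivshar–Sukhorukov solitons review,
irrelevant), `lit read arxiv:0808.3256 --grep Buttiker|self-consistent` (Dhar2008 §3.5:
self-consistent reservoirs ~ Buttiker probes ⇒ Fourier for the harmonic host,
BonettoLebowitzLukkarinen2004); local searchd, OpenAlex and arXiv APIs were unavailable/rate-limited
during the session (logged in NOTES.md).
Nearest prior art found: Gallavotti1969 / Spohn1978 (Boltzmann–Grad limit of the Lorentz gas: dilute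
STATIC scatterers, point particles); doi:10.1142/s0129055x0500242x (Eng–Erdős 2005: linear Boltzmann
as the LOW-DENSITY limit of the random Schrödinger equation — the wave analogue of the dilute axis,
elastic scatterers)  [refs: 10.1142/s0129055x0500242x, 2510.20003, 2310.13338, 0808.3256, arxiv:0808.3256, doi:10.1142/s0129055x0500242x, Dhar2008, BonettoLebowitzLukkarinen2004, Gallavotti1969, Spohn1978, JaksicPillet1998, BonettoMaiocchi2026, Buttiker1986, BricmontKupiainen2013, DharLebowitz2008]

Barriers (technique_class: dilute-nonlinearity renewal-limit, conductance-comparison): - technique_class: dilute-nonlinearity renewal-limit, conductance-comparison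
- Literature.Barriers.AtomisticToContinuum.HarmonicChainBallisticFlux: used, not fought — the
harmonic segments are the free flights (proved fact HarmonicChainBallisticFlux_holds supplies c_∞
and the no-resistance of the host); every resistance in the route sits at a quartic cell, and
nothing in the line survives setting lam = β = 0 at the cells (r₁ = 0 there), so it is not an
effective-linear-dynamics argument.
- Literature.Barriers.AtomisticToContinuum.LowTemperatureWeakAnharmonicity: all statements are at
fixed T > 0 with T-dependent ℓ₀(T), m_T, r₁(T); as T ↓ 0 the cells linearise, τ(T) → 1, r₁(T) → 0
and ℓ₀(T) → ∞, consistently with κ ~ (λT)⁻²; no constant is claimed uniform as T → 0, so the line is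
outside the 'uniform near the harmonic chain' class.
- Literature.Barriers.AtomisticToContinuum.HasBoundedResponse: this is the route's TARGET X_bdd,
reached not by fixed-N NESS analysis (the blocked class: hypoellipticity, Lyapunov functions,
fixed-N linear response with N-uncontrolled constants) but by an N-uniform mechanism — renewal over
cells whose constants depend on (T, ℓ) only — plus comparison in the cell set; the fixed-N inputs
used (NessUnique, FiniteResponseOfUnique) are plumbing, not the source of N-uniformity.
- Literature.Barriers.AtomisticToContinuum.MacroErgodicityBarrier: evaded inside the kinetic window
(only single-cell mixing in a Gaussian medium is used, no ergodic hypothesis on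

History (route lifecycle, newest last):
- 2026-08-15T13:41:48Z · CLOSED retired — not-a-thesis: assembly does not conclude the sub-problem Statement (operator:999:1257524)

sub-problem: FouriersLaw · status: closed(retired) · opened planner-plancard-AtomisticToContinuum-Fourier-7928271c-0 2026-08-15T11:19:54Z · rev 1 · ledger route-AtomisticToContinuum-DilutePhononLorentzGas
GENERATED by the gate from the ledger (D-0016/17). Provers cite these decls: `theorem foo : Summit.AtomisticToContinuum.FouriersLaw.Theses.DilutePhononLorentzGas.<Decl> := …` in Summits/AtomisticToContinuum/FouriersLaw/Theorems/<Name>.lean.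
-/

namespace Summit.AtomisticToContinuum.FouriersLaw.Theses.DilutePhononLorentzGas

open scoped BigOperators Topology Manifold Classical MeasureTheory ProbabilityTheory Matrix InnerProductSpace ComplexConjugate ContinuousMap
open Filter Set Function TopologicalSpace MeasureTheory

attribute [summit_statement] _root_.FouriersLaw

-- item stmt-AtomisticToContinuum-3669 · crux · rank 2 · closed · moot by None · by planner — informal only, no Lean statement yet:
--   [crux] ONE CELL THERMALISES IN THE LATTICE FIELD (card item CellMixing; needs definition CellChain /
--   its infinite-volume one-cell version): the infinite chain on ℤ that is harmonic (pinning ω₂ > 0,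
--   unit nearest-neighbour coupling) except for the conjunct's quartic pinning lam·q₀⁴/4 at site 0 and
--   quartic coupling β(q₁−q₀)⁴/4 on the bond (0,1), ω₂, lam, β > 0, in its Gibbs state at temperature T
--   > 0 (Gaussian away from the cell; Hamiltonian dynamics well posed in a weighted energy space,
--   Lanford–Lebowitz–Lieb pattern as in InfiniteChainDynamics), is MIXING for cell-local observables:
--   Cov_T(F, G∘

-- item stmt-AtomisticToContinuum-3679 · crux · rank 3 · closed · moot by None · by planner — informal only, no Lean statement yet:
--   [crux] ADDING QUARTIC CELLS TO THE ORDERED HOST NEVER HELPS CONDUCTION (the route's comparison step;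
--   needs definition CellChain): for the cell chains P_c = cellChain ω₂ lam β γ c — the ω₂-pinned,
--   unit-coupling harmonic chain between Langevin baths γ in which the conjunct's quartic terms
--   lam·q_i⁴/4 and β(q_{i+1}−q_i)⁴/4 are switched on exactly at the sites/bonds i with c i = true (c : ℕ
--   → Bool; c ≡ true is pinnedChain ω₂ lam β γ, c ≡ false is pinnedChain ω₂ 0 0 γ) — all of ω₂, lam, β,
--   γ > 0, every T > 0 and every pair of indicators c ≤ c′ (pointwise): there is N₀ such that for N ≥
--   N₀, along all

-- item stmt-AtomisticToContinuum-3680 · crux · rank 4 · closed · moot by None · by planner — informal only, no Lean statement yet: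
--   [crux] THE DILUTE LADDER'S TOP RUNG — PERIODIC DILUTE CHAINS HAVE N-UNIFORMLY BOUNDED κ_N (card
--   items DiluteMarkovLimit + step (4) 'beyond the window'; needs definition CellChain): for all ω₂,
--   lam, β, γ > 0 and every T > 0 there is ℓ₀ such that for every ℓ ≥ ℓ₀ the periodic cell chain P_ℓ =
--   cellChain ω₂ lam β γ c_ℓ (c_ℓ i = true iff i ≡ ℓ−1 mod ℓ: the conjunct's quartic terms on every ℓ-th
--   site/bond of the ω₂-pinned harmonic host, Langevin baths γ at the two ends) satisfies the analogue
--   of HasBoundedResponse at temperature T: along every steady-state family and every sequence of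
--   response limit

/-- item stmt-AtomisticToContinuum-2187 · crux · rank 5 · closed · moot by None · by planner
why it might fail: anomalous (super-diffusive) conduction despite pinning would make κ_N unbounded; not expected for lam, β > 0 (J ~ 1/N numerically) but open for every deterministic anharmonic chain (BLR2000 §6.3), and false at lam = β = 0 (not_hasBoundedResponse).
sources: BonettoLebowitzReyBellet2000, AokiLukkarinenSpohn2006, BonettoLebowitzLukkarinenOlla2009
[crux] BOUNDED RESPONSE = the catalogued necessary waypoint
Literature.Barriers.AtomisticToContinuum.HasBoundedResponse (pinnedChain ω₂ lam β γ) for all ω₂,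
lam, β, γ > 0: along every steady-state family and every T > 0 the finite-size conductivities |D_N|
are bounded in N (J ≤ C δT/N). Necessary for the conjunct (hasBoundedResponse_of_fouriersLawFor,
proved in tree) and FALSE at lam = β = 0 (HarmonicChainBallisticFlux.not_hasBoundedResponse), so any
proof uses anharmonicity non-perturbatively; under NessUnique the family quantifier collapses to the
canonical family (hasBoundedResponse_iff_of_unique). In the Fekete assembly it is exactly what
upgrades ℓ = lim R_N/N ≥ 0 to ℓ ≥ 1/S > 0, i.e. κ < ∞. This route claims NO new engine for it
(shared residual crux of every FouriersLaw line; the companion cards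
insertion-cost-superadditive-half / superadditive-junction-dichotomy reduce it to the superadditive
half of the series law plus one finite-N certificate, conservation-law-rigidity-local-ohm to a local
Ohm inequality). -/
@[route_item "route-AtomisticToContinuum-DilutePhononLorentzGas"]
def BoundedResponse : Prop :=
  ∀ ω₂ lam β γ : ℝ, 0 < ω₂ → 0 < lam → 0 < β → 0 < γ → Literature.Barriers.AtomisticToContinuum.HasBoundedResponse (Literature.MathematicalPhysics.KineticTheory.HeatConduction.pinnedChain ω₂ lam β γ)

/-- item stmt-AtomisticToContinuum-3566 · crux · rank 6 · closed · moot by None · by planner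
why it might fail: bounded but non-convergent D_N (persistent parity / commensurability oscillations from boundary resonances) or D_N → 0 (insulating limit): lower bounds on the current of deterministic anharmonic chains are as open as upper ones (BLR2000 §6.3, §7).
sources: BonettoLebowitzReyBellet2000, CuneoEckmannHairerReyBellet2018
[crux] the complement on the dense chain: for all parameters > 0, uniqueness of the weak steady
state for all N, T_L, T_R > 0, existence of the response limits D_N(T) along every steady-state
family, and HasBoundedResponse together give clause (ii) of FouriersLawFor: some κ : ℝ → ℝ with κ(T)
> 0 and D_N(T) → κ(T) for every T > 0 (an a-priori linear resistance bound is exactly what a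
subadditivity / compactness-plus-identification argument needs to start; shared territory with
FourierGreenKubo.ThermodynamicLimit and the card fekete-resistance-subadditivity). [deps:
BoundedResponse] [difficulty: open-problem] -/
@[route_item "route-AtomisticToContinuum-DilutePhononLorentzGas"]
def BoundedToFourier : Prop :=
  ∀ ω₂ lam β γ : ℝ, 0 < ω₂ → 0 < lam → 0 < β → 0 < γ → (∀ (N : ℕ) (T_L T_R : ℝ), 0 < T_L → 0 < T_R → ∀ μ ν : MeasureTheory.Measure (Literature.MathematicalPhysics.KineticTheory.HeatConduction.PhaseSpace N), (Literature.MathematicalPhysics.KineticTheory.HeatConduction.pinnedChain ω₂ lam β γ).IsSteadyState N T_L T_R μ → (Literature.MathematicalPhysics.KineticTheory.HeatConduction.pinnedChain ω₂ lam β γ).IsSteadyState N T_L T_R ν → μ = ν) → (∀ μ : (N : ℕ) → ℝ → ℝ → MeasureTheory.Measure (Literature.MathematicalPhysics.KineticTheory.HeatConduction.PhaseSpace N), (∀ (N : ℕ) (T_L T_R : ℝ), 0 < T_L → 0 < T_R → (Literature.MathematicalPhysics.KineticTheory.HeatConduction.pinnedChain ω₂ lam β γ).IsSteadyState N T_L T_R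 (μ N T_L T_R)) → ∀ T : ℝ, 0 < T → ∀ N : ℕ, ∃ D : ℝ, Filter.Tendsto (fun δ : ℝ => (Literature.MathematicalPhysics.KineticTheory.HeatConduction.pinnedChain ω₂ lam β γ).totalCurrent (μ N (T + δ / 2) (T - δ / 2)) / δ) (nhdsWithin 0 {(0 : ℝ)}ᶜ) (nhds D)) → Literature.Barriers.AtomisticToContinuum.HasBoundedResponse (Literature.MathematicalPhysics.KineticTheory.HeatConduction.pinnedChain ω₂ lam β γ) → ∃ κ : ℝ → ℝ, (∀ T, 0 < T → 0 < κ T) ∧ ∀ μ : (N : ℕ) → ℝ → ℝ → MeasureTheory.Measure (Literature.MathematicalPhysics.KineticTheory.HeatConduction.PhaseSpace N), (∀ (N : ℕ) (T_L T_R : ℝ), 0 < T_L → 0 < T_R → (Literature.MathematicalPhysics.KineticTheory.HeatConduction.pinnedChain ω₂ lam β γ).IsSteadyState N T_L T_R (μ N T_L T_R)) → ∀ T : ℝ, 0 < T → ∃ D : ℕ → ℝ, (∀ N : ℕ, Filter.Tendsto (fun δ : ℝ => (Literature.MathematicalPhysics.KineticTheory.HeatConduction.pinnedChain ω₂ lam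 β γ).totalCurrent (μ N (T + δ / 2) (T - δ / 2)) / δ) (nhdsWithin 0 {(0 : ℝ)}ᶜ) (nhds (D N))) ∧ Filter.Tendsto D Filter.atTop (nhds (κ T))

/-- item stmt-AtomisticToContinuum-0717 · support · rank 9 · closed · proved by Summit.AtomisticToContinuum.FouriersLaw.Theorems.FourierGreenKubo.finiteResponseOfUnique_holds (prover) · by planner
sources: arXiv:0909.4313, CuneoEckmannHairerReyBellet2018, BonettoLebowitzReyBellet2000
CONDITIONAL FORM OF 0705 (supersedes it as the prover target; refuters pool-5/g3-0: 0705 stand-alone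
quantifies over EVERY steady-state family and is false-prone if weak steady states were non-unique):
assuming UNIQUENESS of weak steady states (IsSteadyState class) for pinnedChain at all N, T_L, T_R >
0, the finite-N linear-response limit D_N(T) = lim_{δ→0, δ≠0} totalCurrent(μ_{N,T+δ/2,T−δ/2})/δ
exists for every T > 0 and N. Content: differentiability at equilibrium of NESS expectations of the
polynomial currents in the bath temperatures (ReyBellet2003 arXiv:math-ph/0303021 Rem 4.4 (51)–(56)
finite-volume Green–Kubo; HairerMajda2009 arXiv:0909.4313 Thm 2.3 framework — their SDE Thm 4.4
Assumption 5 fails here, so verify Assumptions 1–3 via CEHR2018 (2.5)/Carmona2007 Thm 1.1(iv)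
weighted spectral gap). N = 0, 1: totalCurrent ≡ 0, D = 0. Together with 0706 gives 0705. -/
@[route_item "route-AtomisticToContinuum-DilutePhononLorentzGas"]
def FiniteResponseOfUnique : Prop :=
  ∀ ω₂ lam β γ : ℝ, 0 < ω₂ → 0 < lam → 0 < β → 0 < γ → (∀ (N : ℕ) (T_L T_R : ℝ), 0 < T_L → 0 < T_R → ∀ μ ν : MeasureTheory.Measure (Literature.MathematicalPhysics.KineticTheory.HeatConduction.PhaseSpace N), (Literature.MathematicalPhysics.KineticTheory.HeatConduction.pinnedChain ω₂ lam β γ).IsSteadyState N T_L T_R μ → (Literature.MathematicalPhysics.KineticTheory.HeatConduction.pinnedChain ω₂ lam β γ).IsSteadyState N T_L T_R ν → μ = ν) → ∀ μ : (N : ℕ) → ℝ → ℝ → MeasureTheory.Measure (Literature.MathematicalPhysics.KineticTheory.HeatConduction.PhaseSpace N), (∀ (N : ℕ) (T_L T_R : ℝ), 0 < T_L → 0 < T_R → (Literature.MathematicalPhysics.KineticTheory.HeatConduction.pinnedChain ω₂ lam β γ).IsSteadyState N T_L T_R (μ N T_L T_R)) → ∀ T : ℝ, 0 < T → ∀ N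 : ℕ, ∃ D : ℝ, Filter.Tendsto (fun δ : ℝ => (Literature.MathematicalPhysics.KineticTheory.HeatConduction.pinnedChain ω₂ lam β γ).totalCurrent (μ N (T + δ / 2) (T - δ / 2)) / δ) (nhdsWithin 0 {(0 : ℝ)}ᶜ) (nhds D)

/-- `FiniteResponseOfUnique` holds: proved by `Summit.AtomisticToContinuum.FouriersLaw.Theorems.FourierGreenKubo.finiteResponseOfUnique_holds`. -/
theorem FiniteResponseOfUnique_holds : FiniteResponseOfUnique := _root_.Summit.AtomisticToContinuum.FouriersLaw.Theorems.FourierGreenKubo.finiteResponseOfUnique_holds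

/-- item stmt-AtomisticToContinuum-0741 · support · rank 9 · closed · proved by Summit.AtomisticToContinuum.FouriersLaw.Theorems.nessUnique_proof (prover) · by planner
sources: CuneoEckmannHairerReyBellet2018, ReyBelletThomas2002, Carmona2007
[crux] UNIQUENESS OF THE WEAK STEADY STATE (the half of stmt-0706 not covered by the landed fact
Literature.MathematicalPhysics.KineticTheory.HeatConduction.CuneoEckmannHairerReyBellet2018_pinnedChain,
p3544): for pinnedChain ω₂ lam β γ (all > 0), every N and T_L, T_R > 0, any two measures in the weak
Fokker–Planck class IsSteadyState (probability, ∫ L f dμ = 0 for f ∈ C_c^∞, bond currents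
integrable) coincide. Print: uniqueness of the INVARIANT MEASURE of the Langevin semigroup
(CuneoEckmannHairerReyBellet2018 Thm 2.13(1): C1, C2, CA; Carmona2007 Thm 1.1(iii)); the item
additionally needs 'weak stationary probability solution of L*μ = 0 ⇒ P_t-invariant' for this
hypoelliptic L with cubic drift (Echeverría 1982 well-posed martingale problem on C_c^∞ +
non-explosion via e^{θH}; Bogachev–Krylov–Röckner–Shaposhnikov 2015 Ch. 5 is non-degenerate only) —
the FP-identification lemma is the formal crux. N = 0: PhaseSpace 0 is a point (unique probability
measure); N = 1: both baths on site 0, OU at temperature (T_L+T_R)/2. This is exactly the hypothesis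
of FiniteResponse and ThermodynamicLimit and, with the fact, gives clause (i) of FouriersLawFor. -/
@[route_item "route-AtomisticToContinuum-DilutePhononLorentzGas"]
def NessUnique : Prop :=
  ∀ ω₂ lam β γ : ℝ, 0 < ω₂ → 0 < lam → 0 < β → 0 < γ → ∀ (N : ℕ) (T_L T_R : ℝ), 0 < T_L → 0 < T_R → ∀ μ ν : MeasureTheory.Measure (Literature.MathematicalPhysics.KineticTheory.HeatConduction.PhaseSpace N), (Literature.MathematicalPhysics.KineticTheory.HeatConduction.pinnedChain ω₂ lam β γ).IsSteadyState N T_L T_R μ → (Literature.MathematicalPhysics.KineticTheory.HeatConduction.pinnedChain ω₂ lam β γ).IsSteadyState N T_L T_R ν → μ = ν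

/-- `NessUnique` holds: proved by `Summit.AtomisticToContinuum.FouriersLaw.Theorems.nessUnique_proof`. -/
theorem NessUnique_holds : NessUnique := _root_.Summit.AtomisticToContinuum.FouriersLaw.Theorems.nessUnique_proof

/-- item stmt-AtomisticToContinuum-3567 · assembly · rank 1 · closed · moot by None · by planner
sources: BonettoLebowitzReyBellet2000, CuneoEckmannHairerReyBellet2018
[assembly] CuneoEckmannHairerReyBellet2018_pinnedChain → NessUnique → FiniteResponseOfUnique →
BoundedResponse → BoundedToFourier → FouriersLaw. -/
@[route_item "route-AtomisticToContinuum-DilutePhononLorentzGas"]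
def Assembly : Prop :=
  Literature.MathematicalPhysics.KineticTheory.HeatConduction.CuneoEckmannHairerReyBellet2018_pinnedChain → (∀ ω₂ lam β γ : ℝ, 0 < ω₂ → 0 < lam → 0 < β → 0 < γ → ∀ (N : ℕ) (T_L T_R : ℝ), 0 < T_L → 0 < T_R → ∀ μ ν : MeasureTheory.Measure (Literature.MathematicalPhysics.KineticTheory.HeatConduction.PhaseSpace N), (Literature.MathematicalPhysics.KineticTheory.HeatConduction.pinnedChain ω₂ lam β γ).IsSteadyState N T_L T_R μ → (Literature.MathematicalPhysics.KineticTheory.HeatConduction.pinnedChain ω₂ lam β γ).IsSteadyState N T_L T_R ν → μ = ν) → (∀ ω₂ lam β γ : ℝ, 0 < ω₂ → 0 < lam → 0 < β → 0 < γ → (∀ (N : ℕ) (T_L T_R : ℝ), 0 < T_L → 0 < T_R → ∀ μ ν : MeasureTheory.Measure (Literature.MathematicalPhysics.KineticTheory.HeatConduction.PhaseSpace N), (Literature.MathematicalPhysics.KineticTheory.HeatConduction.pinnedChain ω₂ lam β γ).IsSteadyState N T_L T_R μ → (Literature.MathematicalPhysics.KineticTheory.HeatConduction.pinnedChain ω₂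 lam β γ).IsSteadyState N T_L T_R ν → μ = ν) → ∀ μ : (N : ℕ) → ℝ → ℝ → MeasureTheory.Measure (Literature.MathematicalPhysics.KineticTheory.HeatConduction.PhaseSpace N), (∀ (N : ℕ) (T_L T_R : ℝ), 0 < T_L → 0 < T_R → (Literature.MathematicalPhysics.KineticTheory.HeatConduction.pinnedChain ω₂ lam β γ).IsSteadyState N T_L T_R (μ N T_L T_R)) → ∀ T : ℝ, 0 < T → ∀ N : ℕ, ∃ D : ℝ, Filter.Tendsto (fun δ : ℝ => (Literature.MathematicalPhysics.KineticTheory.HeatConduction.pinnedChain ω₂ lam β γ).totalCurrent (μ N (T + δ / 2) (T - δ / 2)) / δ) (nhdsWithin 0 {(0 : ℝ)}ᶜ) (nhds D)) → (∀ ω₂ lam β γ : ℝ, 0 < ω₂ → 0 < lam → 0 < β → 0 < γ → Literature.Barriers.AtomisticToContinuum.HasBoundedResponse (Literature.MathematicalPhysics.KineticTheory.HeatConduction.pinnedChain ω₂ lam β γ)) → (∀ ω₂ lam β γ : ℝ, 0 < ω₂ → 0 < lam → 0 < β → 0 < γ → (∀ (N : ℕ) (T_L T_R : ℝ), 0 <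 T_L → 0 < T_R → ∀ μ ν : MeasureTheory.Measure (Literature.MathematicalPhysics.KineticTheory.HeatConduction.PhaseSpace N), (Literature.MathematicalPhysics.KineticTheory.HeatConduction.pinnedChain ω₂ lam β γ).IsSteadyState N T_L T_R μ → (Literature.MathematicalPhysics.KineticTheory.HeatConduction.pinnedChain ω₂ lam β γ).IsSteadyState N T_L T_R ν → μ = ν) → (∀ μ : (N : ℕ) → ℝ → ℝ → MeasureTheory.Measure (Literature.MathematicalPhysics.KineticTheory.HeatConduction.PhaseSpace N), (∀ (N : ℕ) (T_L T_R : ℝ), 0 < T_L → 0 < T_R → (Literature.MathematicalPhysics.KineticTheory.HeatConduction.pinnedChain ω₂ lam β γ).IsSteadyState N T_L T_R (μ N T_L T_R)) → ∀ T : ℝ, 0 < T → ∀ N : ℕ, ∃ D : ℝ, Filter.Tendsto (fun δ : ℝ => (Literature.MathematicalPhysics.KineticTheory.HeatConduction.pinnedChain ω₂ lam β γ).totalCurrent (μ N (T + δ / 2) (T - δ / 2)) / δ) (nhdsWithin 0 {(0 : ℝ)}ᶜ) (nhds D)) → Literature.Barriers.AtomisticToContinuum.HasBoundedResponse (Literature.MathematicalPhysics.KineticTheory.HeatConduction.pinnedChain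 ω₂ lam β γ) → ∃ κ : ℝ → ℝ, (∀ T, 0 < T → 0 < κ T) ∧ ∀ μ : (N : ℕ) → ℝ → ℝ → MeasureTheory.Measure (Literature.MathematicalPhysics.KineticTheory.HeatConduction.PhaseSpace N), (∀ (N : ℕ) (T_L T_R : ℝ), 0 < T_L → 0 < T_R → (Literature.MathematicalPhysics.KineticTheory.HeatConduction.pinnedChain ω₂ lam β γ).IsSteadyState N T_L T_R (μ N T_L T_R)) → ∀ T : ℝ, 0 < T → ∃ D : ℕ → ℝ, (∀ N : ℕ, Filter.Tendsto (fun δ : ℝ => (Literature.MathematicalPhysics.KineticTheory.HeatConduction.pinnedChain ω₂ lam β γ).totalCurrent (μ N (T + δ / 2) (T - δ / 2)) / δ) (nhdsWithin 0 {(0 : ℝ)}ᶜ) (nhds (D N))) ∧ Filter.Tendsto D Filter.atTop (nhds (κ T))) → Literature.MathematicalPhysics.KineticTheory.HeatConduction.FouriersLaw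

end Summit.AtomisticToContinuum.FouriersLaw.Theses.DilutePhononLorentzGas
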